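import Summits.BirchSwinnertonDyer.BirchSwinnertonDyer.Theorems.ResidualThetaTransportAtTwoCompactSelmerTowerVanishing
import Summits.BirchSwinnertonDyer.BirchSwinnertonDyer.Theorems.ResidualThetaTransportAtTwoLayerH1TorsionFree
import Literature.NumberTheory.EllipticCurves.Kato2004.IwasawaCohomologyUniqueProofs
import Literature.NumberTheory.EllipticCurves.Kato2004.IwasawaH1LambdaTorsionFreeProofs
import Literature.NumberTheory.EllipticCurves.Kato2004.UniversalNormsIntegralProofs
import HarnessLib

/-!
# The `Λ`-adic road to SURJ⁺@2 (item 23110 at every rank), inputs (Λ1) and (Λ4) DISCHARGED on Kato's pin: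
# a norm-compatible family of classes of `T_pE` along the cyclotomic tower that lives in `γ`-stable `ℤ_p`-submodules of
# BOUNDED rank inside torsion-free layers is ZERO — the tower-vanishing lemma run on `𝐇¹_Γ(T_pE)`

Routes `ResidualThetaTransportAtTwo` (RTT, crux r201 `ResidualLambdaFormulaNegDiscAtTwo`, stmt-BirchSwinnertonDyer-23110) /
`ThetaPartnerAtTwo` (K1 `stub_surj2`; K3 aside). Seat `prover-bsd-wall-tp2-p2x-w2` g14 (width of the K3 lead tp2-p2x g12, who holds
23110); `--supports stmt-BirchSwinnertonDyer-23110`. THEOREMS ONLY (no definition, no named fact, no `sorry`); closes nothing.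

WHY (memo ALL-RANK-RLF-ROADS-w4g0 §4, seat rtt-w4). SURJ⁺@2 for ONE curve of ANY rank follows from Poitou–Tate at the layers
`ℚ_m` once the universal-norm compact `+` Selmer group `𝔖⁺_∞ = lim←_m 𝔖⁺(E/ℚ_m)` vanishes, and the pure-algebra TOWER-VANISHING
LEMMA `forall_eq_zero_of_antitone_of_rank_le_of_smul_mem` (p645112) kills `𝔖⁺_∞` from four inputs: (Λ1) `𝔖⁺_∞` is a torsion-free
`Λ`-module, (Λ2) the layers are torsion-free `ℤ_p`-modules, (Λ3) of bounded rank, (Λ4) the kernels of `𝔖⁺_∞ → 𝔖⁺(E/ℚ_m)` decrease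
to `0` and contain `ω_m 𝔖⁺_∞`, `ω_m ≠ 0`. THIS FILE runs the lemma ON KATO'S PINNED IWASAWA COHOMOLOGY `I : IwasawaH1Data W p κ γ`
(`𝐇¹_Γ(T_pW) = lim← H¹(ℤ_n[1/p], T_pW)`, Kato §12.2) for an ARBITRARY family `S n ⊆ H¹(ℚ_n, T_pW)` of `conj_γ`-stable
`ℤ_p`-submodules, so that (Λ1) and (Λ4) disappear as hypotheses:

* (Λ1) is Kato Thm. 12.4 (2), first half — tree THEOREM `IwasawaH1Data.noZeroSMulDivisors` (`IwasawaH1LambdaTorsionFreeProofs`) —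
  applied to the `Λ`-SUBMODULE `{x ∈ 𝐇¹ | ∀ n, proj_n x ∈ S n}`; it IS a `Λ`-submodule because the `Λ`-action of the pin is levelwise
  (`IwasawaH1Data.proj_smul`: `proj_n (f • x) = r(conj_γ − 1)(proj_n x)`, `r ≡ f mod ω_n`) and `S n` is `conj_γ`-stable
  (`Polynomial.aeval_apply_smul_mem_of_le_comap`);
* (Λ4) is `IwasawaH1Data.proj_omega_smul` (`proj_n (ω_n • x) = 0`), `cores_proj` (kernels decrease) and `proj_injective`
  (they separate), with `ω_n = (1+X)^{p^n} − 1 ≠ 0` (`omega_coe_ne_zero`);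
* the EMBEDDING `𝔖_∞ ↪ 𝐇¹` of a norm-compatible family of layer classes is Kato's Lemma 8.5 (2) — tree THEOREM
  `UniversalNorms.mem_integralH1_of_layerCores_eq` (`UniversalNormsIntegralProofs`: EVERY norm-compatible family along a cyclotomic
  `ℤ_p`-tower is integral, no hypothesis) — plus `proj_surjective` and the existence of the pin `IwasawaH1Exists.nonempty_iwasawaH1Data_holds`.

Results (every `E/ℚ`, every prime `p`, every `ℤ_p`-extension `κ` with topological generator `γ`; cyclotomic where Lemma 8.5 enters):

* `eq_zero_of_forall_proj_mem_of_rank_le` — PIN FORM: if the layers `H¹(ℚ_n, T_pW)` have no `p`-torsion (shape of (Λ2),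
  `layerH1_eq_zero_of_pow_smul_eq_zero_of_fixedPoints_eq_bot`) and `rank_{ℤ_p} (S n) ≤ B` for all `n`, then every `x ∈ I.H` with
  `proj_n x ∈ S n` for all `n` is `0`;
* `forall_eq_zero_of_layerCores_eq_of_mem_of_rank_le` — PIN-FREE FORM: every norm-compatible family `z_n ∈ H¹(ℚ_n, T_pW)`
  (`layerCores z_{n+1} = z_n`) with `z_n ∈ S n` for all `n` is identically `0` («the universal norms of a bounded-rank tower vanish»);
* `forall_eq_zero_of_layerCores_eq_of_mem_of_rank_le_of_goodSS` — `p = 2`, `E` globally minimal with good supersingular reduction at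
  `2`: (Λ2) plugged in (`layerH1_eq_zero_of_pow_smul_eq_zero_of_goodSS`), so ONLY the `γ`-stable bounded-rank family `S` is displayed.

WHAT REMAINS of road Λ after this file (not done here): the compact `+` Selmer layers `𝔖⁺(E/ℚ_n) ⊆ H¹(ℚ_n, T₂E)` as the family `S`
(`conj_γ`-stable; `rank ≤ λ⁺` from (Λ3) `zpCorank_signedSelmerLayer_le_lambda`, p645699) and the layer Poitou–Tate / Mittag-Leffler
plumbing `𝔖⁺_∞ = 0 ⟹ SURJ♯`. HONEST FRAMING: closes nothing; 23110 is NOT proved; BSD is not proved by any of this.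
References: [GreenbergVatsal2000] §2 Prop. (2.1); [Kato2004Asterisque] §8.2, Lemma 8.5 (2) (p. 183), §12.2 (p. 220), Thm. 12.4 (2)
(p. 221); [PerrinRiou1992] (universal norms); [Lang1990] Ch. 5 §1 Thm. 1.1; [NeukirchSchmidtWingberg2008] Ch. V §3.
-/

set_option autoImplicit false
-- D-0017: single-problem summit, so `Summit.BirchSwinnertonDyer.BirchSwinnertonDyer.…` repeats a namespace BY DESIGN.
set_option linter.dupNamespace false

noncomputable section

open Polynomial Field CategoryTheory
open Literature.NumberTheory.GaloisRepresentations
open Literature.NumberTheory.EllipticCurves Literature.NumberTheory.EllipticCurves.Kato2004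
open Literature.NumberTheory.EllipticCurves.Kato2004.EulerSystemValues

namespace Summit.BirchSwinnertonDyer.BirchSwinnertonDyer.Theorems.ResidualThetaLayer.TowerVanishing

variable {p : ℕ} [Fact p.Prime]

/-- **`ω_n = (1+X)^{p^n} − 1 ≠ 0` in `Λ = ℤ_p⟦X⟧`**: the polynomial `(X+1)^{p^n}` is monic of degree `p^n ≥ 1`, so it is not `1`,
and `ℤ_p[X] ↪ ℤ_p⟦X⟧`. [cite: Lang1990, Ch. 5 §1 (the polynomials `ω_n`)] [folklore] -/
theorem omega_coe_ne_zero (n : ℕ) :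
    (((X + 1 : ℤ_[p][X]) ^ p ^ n - 1 : ℤ_[p][X]) : PowerSeries ℤ_[p]) ≠ 0 := by
  rw [Ne, Polynomial.coe_eq_zero_iff, sub_eq_zero]
  intro h
  have h1 : (X + 1 : ℤ_[p][X]) = X + C 1 := by rw [C_1]
  rw [h1] at h
  have hdeg := congrArg Polynomial.natDegree h
  rw [(monic_X_add_C (1 : ℤ_[p])).natDegree_pow, natDegree_X_add_C, mul_one, natDegree_one] at hdeg
  exact pow_ne_zero n (Fact.out : p.Prime).ne_zero hdeg

section Pin

variable {W : WeierstrassCurve ℚ} [W.IsElliptic] [ContinuousSMul ℤ_[p] (W.tateModule p)]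
  {κ : ZpExtension ℚ p} {γ : absoluteGaloisGroup ℚ}

/-- **The tower-vanishing lemma on Kato's pin `𝐇¹_Γ(T_pW)` (inputs (Λ1), (Λ4) discharged).** Let `I : IwasawaH1Data W p κ γ`
(`γ` a topological generator), and let `S n ⊆ H¹(ℚ_n, T_pW)` be `conj_γ`-stable `ℤ_p`-submodules of `ℤ_p`-rank `≤ B` for every
`n`; assume the layers `H¹(ℚ_n, T_pW)` have no `p`-torsion. Then every `x ∈ 𝐇¹` whose projections all lie in the `S n` is `0`.
Proof: `M = {x | ∀ n, proj_n x ∈ S n}` is a `Λ`-submodule (`proj_smul` + stability), torsion-free over `Λ` (Kato Thm. 12.4 (2),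
`noZeroSMulDivisors`); with `K n = M ∩ ker proj_n` (decreasing by `cores_proj`, separating by `proj_injective`, `M ⧸ K n ↪ S n`
torsion-free of rank `≤ B`, `ω_n M ⊆ K n` by `proj_omega_smul`, `ω_n ≠ 0`) the pure-algebra lemma
`forall_eq_zero_of_antitone_of_rank_le_of_smul_mem` gives `M = 0`.
[cite: GreenbergVatsal2000, §2 Prop. (2.1)] [cite: Kato2004Asterisque, §12.2 (p. 220) and Thm. 12.4 (2) (p. 221)]
[cite: Lang1990, Ch. 5 §1 Thm. 1.1] -/
theorem eq_zero_of_forall_proj_mem_of_rank_le (hγ : κ.IsTopGenerator γ) (I : IwasawaH1Data W p κ γ)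
    (S : ∀ n : ℕ, Submodule ℤ_[p] (H1 (tateRep W p) (κ.layerSubgroup n)))
    (hS : ∀ (n : ℕ) (y : H1 (tateRep W p) (κ.layerSubgroup n)), y ∈ S n →
      conjMap (tateRep W p).toTopRep (κ.layerSubgroup n) γ 1 y ∈ S n)
    (htf : ∀ (n k : ℕ) (y : H1 (tateRep W p) (κ.layerSubgroup n)), ((p : ℤ_[p]) ^ k) • y = 0 → y = 0)
    (B : ℕ) (hB : ∀ n, Module.rank ℤ_[p] (S n) ≤ B)
    (x : I.H) (hx : ∀ n, I.proj n x ∈ S n) : x = 0 := by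
  classical
  -- the `ℤ_p`-structure of `𝐇¹` (that of `RestrictScalars ℤ_p Λ 𝐇¹`)
  letI : Module ℤ_[p] I.H := Module.compHom I.H (algebraMap ℤ_[p] (IwasawaAlgebra p))
  haveI : IsScalarTower ℤ_[p] (IwasawaAlgebra p) I.H := IsScalarTower.of_compHom _ _ _
  have hprojC : ∀ (n : ℕ) (c : ℤ_[p]) (y : I.H), I.proj n (c • y) = c • I.proj n y := fun n c y ↦ by
    rw [← algebraMap_smul (IwasawaAlgebra p) c y, ← PowerSeries.C_eq_algebraMap, I.proj_C_smul]
  -- the level operators `θ_n = conj_γ` preserve `S n`, hence so does every polynomial in `θ_n − 1`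
  have hθ : ∀ (n : ℕ), S n ≤ (S n).comap
      ((conjMap (tateRep W p).toTopRep (κ.layerSubgroup n) γ 1).hom.toLinearMap - 1) := fun n y hy ↦ by
    rw [Submodule.mem_comap, LinearMap.sub_apply, Module.End.one_apply]
    exact (S n).sub_mem (hS n y hy) hy
  -- (M) the `Λ`-submodule of `𝐇¹` cut out by `S`
  let M : Submodule (IwasawaAlgebra p) I.H :=
    { carrier := {y | ∀ n, I.proj n y ∈ S n}
      zero_mem' := fun n ↦ by rw [map_zero]; exact (S n).zero_mem
      add_mem' := fun {a b} ha hb n ↦ by rw [map_add]; exact (S n).add_mem (ha n) (hb n)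
      smul_mem' := fun f y hy n ↦ by
        obtain ⟨r, hr⟩ := IwasawaH1Exists.exists_polynomial_sub_coe_mem_span p n f
        rw [I.proj_smul hγ n hr y]
        exact Polynomial.aeval_apply_smul_mem_of_le_comap (hy n) r _ (hθ n) }
  have hxM : x ∈ M := hx
  -- the projections as `ℤ_p`-linear maps on `M`, and their kernels `K n`
  let π : ∀ n : ℕ, M →ₗ[ℤ_[p]] H1 (tateRep W p) (κ.layerSubgroup n) := fun n ↦
    { toFun := fun y ↦ I.proj n (y : I.H)
      map_add' := fun a b ↦ by rw [Submodule.coe_add, map_add]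
      map_smul' := fun c y ↦ by rw [Submodule.coe_smul_of_tower, RingHom.id_apply, hprojC] }
  have hπ : ∀ (n : ℕ) (y : M), π n y = I.proj n (y : I.H) := fun n y ↦ rfl
  let K : ℕ → Submodule ℤ_[p] M := fun n ↦ LinearMap.ker (π n)
  have hKmem : ∀ (n : ℕ) (y : M), y ∈ K n ↔ I.proj n (y : I.H) = 0 := fun n y ↦ LinearMap.mem_ker
  -- (Λ4a) the kernels decrease (`proj_n = Cor ∘ proj_{n+1}`)
  have hstep : ∀ (n : ℕ) (y : I.H), I.proj (n + 1) y = 0 → I.proj n y = 0 := fun n y h ↦ by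
    rw [← I.cores_proj n y, h, map_zero]
  have hanti : Antitone K := antitone_nat_of_succ_le fun n y hy ↦ by
    rw [hKmem] at hy ⊢
    exact hstep n _ hy
  -- (Λ4b) they separate (`proj_injective`)
  have hsep : ∀ m : M, (∀ n, m ∈ K n) → m = 0 := fun m hm ↦
    Subtype.ext (I.proj_injective _ fun n ↦ (hKmem n m).mp (hm n))
  -- (Λ2) the layers are torsion-free `ℤ_p`-modules
  have htfV : ∀ n, Module.IsTorsionFree ℤ_[p] (H1 (tateRep W p) (κ.layerSubgroup n)) := fun n ↦
    Module.IsTorsionFree.of_smul_eq_zero fun r y h ↦ or_iff_not_imp_left.mpr fun hr ↦ by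
      obtain ⟨u, k, hru⟩ : ∃ (u : ℤ_[p]ˣ) (k : ℕ), r = (u : ℤ_[p]) * (p : ℤ_[p]) ^ k :=
        ⟨_, _, PadicInt.unitCoeff_spec hr⟩
      refine htf n k y ?_
      have h2 : ((u⁻¹ : ℤ_[p]ˣ) : ℤ_[p]) • (r • y) = 0 := by rw [h, smul_zero]
      rwa [hru, ← mul_smul, ← mul_assoc, Units.inv_mul, one_mul] at h2
  have htfK : ∀ n, Module.IsTorsionFree ℤ_[p] (M ⧸ K n) := fun n ↦ by
    haveI := htfV n
    exact (LinearMap.quotKerEquivRange (π n)).injective.moduleIsTorsionFree _ fun c z ↦ map_smul _ c z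
  -- (Λ3) bounded rank: `M ⧸ K n ≅ range (π n) ⊆ S n`
  have hrank : ∀ n, Module.rank ℤ_[p] (M ⧸ K n) ≤ B := fun n ↦ by
    rw [(LinearMap.quotKerEquivRange (π n)).rank_eq]
    have hle : LinearMap.range (π n) ≤ S n := by
      rintro _ ⟨y, rfl⟩
      rw [hπ]
      exact y.2 n
    exact (Submodule.rank_mono hle).trans (hB n)
  -- (Λ4c) `ω_n ≠ 0` kills `M` modulo `K n`
  have hkill : ∀ n, ∃ a : IwasawaAlgebra p, a ≠ 0 ∧ ∀ m : M, a • m ∈ K n := fun n ↦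
    ⟨_, omega_coe_ne_zero n, fun m ↦ (hKmem n _).mpr (by
      rw [Submodule.coe_smul]; exact I.proj_omega_smul hγ n (m : I.H))⟩
  -- (Λ1) `M` is torsion-free over `Λ` (Kato Thm. 12.4 (2))
  have htfR : ∀ (a : IwasawaAlgebra p) (m : M), a • m = 0 → a = 0 ∨ m = 0 := fun a m h ↦ by
    haveI := I.noZeroSMulDivisors hγ
    have h' : a • (m : I.H) = 0 := by rw [← Submodule.coe_smul, h, Submodule.coe_zero]
    exact (smul_eq_zero.mp h').imp_right fun hm ↦ Subtype.ext hm
  -- the tower-vanishing lemma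
  have hzero := forall_eq_zero_of_antitone_of_rank_le_of_smul_mem (R := IwasawaAlgebra p) (A := ℤ_[p])
    htfR K hanti hsep htfK B hrank hkill ⟨x, hxM⟩
  exact congrArg Subtype.val hzero

/-- **Universal norms of a bounded-rank tower vanish (pin-free form; inputs (Λ1), (Λ4) and the embedding into `𝐇¹` discharged).**
For an elliptic curve `E/ℚ`, a prime `p`, the CYCLOTOMIC `ℤ_p`-extension `κ` with topological generator `γ`, and `conj_γ`-stable
`ℤ_p`-submodules `S n ⊆ H¹(ℚ_n, T_pE)` of rank `≤ B`, inside layers without `p`-torsion: every norm-compatible family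
`z_n ∈ H¹(ℚ_n, T_pE)` (`Cor z_{n+1} = z_n`) with `z_n ∈ S n` for all `n` is identically `0`. The family is integral by Kato's
Lemma 8.5 (2) (`UniversalNorms.mem_integralH1_of_layerCores_eq`, a theorem), hence an element of the pin
(`nonempty_iwasawaH1Data_holds`, `proj_surjective`), and `eq_zero_of_forall_proj_mem_of_rank_le` applies.
[cite: Kato2004Asterisque, Lemma 8.5 (2) (p. 183), §12.2 (p. 220), Thm. 12.4 (2) (p. 221)] [cite: GreenbergVatsal2000, §2 Prop. (2.1)] -/
theorem forall_eq_zero_of_layerCores_eq_of_mem_of_rank_le (hκ : κ.IsCyclotomic) (hγ : κ.IsTopGenerator γ)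
    (S : ∀ n : ℕ, Submodule ℤ_[p] (H1 (tateRep W p) (κ.layerSubgroup n)))
    (hS : ∀ (n : ℕ) (y : H1 (tateRep W p) (κ.layerSubgroup n)), y ∈ S n →
      conjMap (tateRep W p).toTopRep (κ.layerSubgroup n) γ 1 y ∈ S n)
    (htf : ∀ (n k : ℕ) (y : H1 (tateRep W p) (κ.layerSubgroup n)), ((p : ℤ_[p]) ^ k) • y = 0 → y = 0)
    (B : ℕ) (hB : ∀ n, Module.rank ℤ_[p] (S n) ≤ B)
    (z : ∀ n : ℕ, H1 (tateRep W p) (κ.layerSubgroup n))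
    (hz : ∀ n, layerCores (tateRep W p) κ n (z (n + 1)) = z n) (hzS : ∀ n, z n ∈ S n) (n : ℕ) :
    z n = 0 := by
  have hint : IsNormCompatible (tateRep W p) κ z :=
    ⟨fun m ↦ UniversalNorms.mem_integralH1_of_layerCores_eq W p κ hκ z hz m, hz⟩
  obtain ⟨I⟩ := IwasawaH1Exists.nonempty_iwasawaH1Data_holds W p κ γ hκ hγ
  obtain ⟨x, hx⟩ := I.proj_surjective z hint
  have hx0 : x = 0 :=
    eq_zero_of_forall_proj_mem_of_rank_le hγ I S hS htf B hB x fun m ↦ (hx m).symm ▸ hzS m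
  rw [← hx n, hx0, map_zero]

end Pin

/-- **Road Λ at `p = 2` on the habitat (inputs (Λ1), (Λ2), (Λ4) discharged; (Λ3) displayed).** For `E/ℚ` globally minimal with
good supersingular reduction at `2`, the cyclotomic `ℤ₂`-extension `κ` with topological generator `γ`, and ANY family of
`conj_γ`-stable `ℤ₂`-submodules `S n ⊆ H¹(ℚ_n, T₂E)` of `ℤ₂`-rank `≤ B`: every norm-compatible family of classes `z_n ∈ S n` is
identically `0` (the layers are torsion-free by `layerH1_eq_zero_of_pow_smul_eq_zero_of_goodSS`, `E(ℚ_∞)[2^∞] = 0`). With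
`S n := 𝔖⁺(E/ℚ_n)` the compact `+` Selmer layers (rank `≤ λ⁺` by (Λ3)) this is `𝔖⁺_∞ = 0`, the input of the layer Poitou–Tate step
to SURJ⁺@2 (item 23110 at every rank) — that instantiation is NOT made here.
[cite: GreenbergVatsal2000, §2 Prop. (2.1)] [cite: Kato2004Asterisque, Lemma 8.5 (2) (p. 183) and Thm. 12.4 (2) (p. 221)] -/
theorem forall_eq_zero_of_layerCores_eq_of_mem_of_rank_le_of_goodSS {W : WeierstrassCurve ℚ} [W.IsElliptic]
    [W.IsGloballyMinimal] [ContinuousSMul ℤ_[2] (W.tateModule 2)] (hss : Rank1Residual.GoodSS W 2)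
    {κ : ZpExtension ℚ 2} {γ : absoluteGaloisGroup ℚ} (hκ : κ.IsCyclotomic) (hγ : κ.IsTopGenerator γ)
    (S : ∀ n : ℕ, Submodule ℤ_[2] (H1 (tateRep W 2) (κ.layerSubgroup n)))
    (hS : ∀ (n : ℕ) (y : H1 (tateRep W 2) (κ.layerSubgroup n)), y ∈ S n →
      conjMap (tateRep W 2).toTopRep (κ.layerSubgroup n) γ 1 y ∈ S n)
    (B : ℕ) (hB : ∀ n, Module.rank ℤ_[2] (S n) ≤ B)
    (z : ∀ n : ℕ, H1 (tateRep W 2) (κ.layerSubgroup n))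
    (hz : ∀ n, layerCores (tateRep W 2) κ n (z (n + 1)) = z n) (hzS : ∀ n, z n ∈ S n) (n : ℕ) :
    z n = 0 :=
  forall_eq_zero_of_layerCores_eq_of_mem_of_rank_le hκ hγ S hS
    (fun n k y hy ↦ layerH1_eq_zero_of_pow_smul_eq_zero_of_goodSS hss κ n k y hy) B hB z hz hzS n

end Summit.BirchSwinnertonDyer.BirchSwinnertonDyer.Theorems.ResidualThetaLayer.TowerVanishing

end
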